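import Mathlib.RingTheory.Localization.Module
import Mathlib.LinearAlgebra.FreeModule.PID
import Mathlib.LinearAlgebra.Dual.Basis
import Literature.AlgebraicTopology.SingularHomology.HurewiczProofs
import Literature.AlgebraicTopology.SingularHomology.KroneckerDegreeOne
import Literature.AlgebraicTopology.SingularHomology.IntegralClassRingChange
import HarnessLib

/-!
# A free finitely generated abelian quotient of `π₁(Y)` has rank at most `b₁(Y)`

Topic `Literature/AlgebraicTopology/SingularHomology`; THEOREMS ONLY (no definition, no named fact),
assembled from the tree's degree-one Hurewicz and universal-coefficient theorems.

For a path-connected space `Y` with base point `y`, Hatcher, *Algebraic Topology* (2002), Thm. 2A.1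
(`H₁(Y; ℤ) ≅ π₁(Y, y)ᵃᵇ`, tree: `singularHomology.hurewicz_one_holds`,
`singularHomology.nonempty_abelianization_mulEquiv`) and §3.1 p. 198 with Thm. 3.2
(`H¹(Y; G) ≅ Hom(H₁(Y), G)`, tree: `kroneckerPairing_one_bijective` over `ℤ`; change of coefficients
`ℤ → ℚ` detects classes with a non-zero integral period, tree:
`ringChange_ne_zero_of_kroneckerPairing_ne_zero`) give:

* `singularCohomology.ringChange_one_injective` — **`H¹(Y; ℤ) → H¹(Y; ℚ)` is injective** (in
  degree one `H¹(Y; ℤ) = Hom(H₁(Y; ℤ), ℤ)` is detected by integral cycles);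
* `finrank_le_finrank_singularCohomology_one_of_surjective` — **if `π₁(Y, y)` maps ONTO a finitely
  generated free `ℤ`-module `L` (additively), then `rank_ℤ L ≤ dim_ℚ H¹(Y; ℚ)`**: the `r` coordinate
  functionals of a `ℤ`-basis of `L` give `r` homomorphisms `π₁(Y, y) → ℤ`, i.e. `r` elements of
  `Hom(H₁(Y; ℤ), ℤ) = H¹(Y; ℤ) ↪ H¹(Y; ℚ)`, which stay `ℤ`-linearly — hence `ℚ`-linearly
  (Mathlib `LinearIndependent.iff_fractionRing`) — independent.

Use (cell `pub-hodgecm2`, plan ALB-H1-ISO step S3b): the period group of the holomorphic `1`-forms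
of a compact ball quotient `X = Γ \ 𝔹²` is an additive image of `Γ ≅ π₁(X(ℂ))`, so its rank is at
most `b₁(X) = 2 h^{1,0}(X)` — the rank half of "the periods form a lattice in `H⁰(X, Ω¹)^*`"
(Griffiths–Harris, Ch. 2 §6; Voisin I, §12.1.2).

## References

* [HatcherAT2002] A. Hatcher, *Algebraic Topology* (2002), §2.A Thm. 2A.1; §3.1 Thm. 3.2 and p. 198.
* [GriffithsHarris1978] P. Griffiths, J. Harris, *Principles of Algebraic Geometry* (1978), Ch. 2 §6.
-/

noncomputable section

open Function Module

namespace Literature.AlgebraicTopology.SingularHomology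

variable {Y : Type} [TopologicalSpace Y]

/-! ### `H¹(Y; ℤ) ↪ H¹(Y; ℚ)` -/

/-- **Change of coefficients `ℤ → ℚ` is injective on `H¹`**: a non-zero class `β ∈ H¹(Y; ℤ)` is a
non-zero functional on `H₁(Y; ℤ)` (`H¹ = Hom(H₁, ℤ)` in degree one, `kroneckerPairing_one_injective`),
so it pairs non-trivially with some integral cycle, and then `β ⊗ 1 ≠ 0`
(`ringChange_ne_zero_of_kroneckerPairing_ne_zero`). [cite: HatcherAT2002, §3.1 Thm. 3.2 and p. 198] -/
theorem singularCohomology.ringChange_one_injective :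
    Injective (singularCohomology.ringChange (algebraMap ℤ ℚ) Y 1) := by
  intro β₁ β₂ h
  rw [← sub_eq_zero] at h ⊢
  rw [← map_sub] at h
  by_contra hne
  have hk : kroneckerPairing ℤ ℤ Y 1 (β₁ - β₂) ≠ 0 := fun h0 ↦
    hne (kroneckerPairing_one_injective ℤ (by rw [h0, map_zero]))
  obtain ⟨z, hz⟩ := DFunLike.ne_iff.1 hk
  exact ringChange_ne_zero_of_kroneckerPairing_ne_zero ℚ _ z hz h

/-! ### Rank of free abelian quotients of `π₁` -/

section Rank

variable [PathConnectedSpace Y] (y : Y) {L : Type} [AddCommGroup L]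

/-- **A homomorphism `π₁(Y, y) → L` to an abelian group factors through `H₁(Y; ℤ)`**, additively and
onto if it was onto: `π₁ → π₁ᵃᵇ ≅ H₁(Y; ℤ)` (Hurewicz, Hatcher Thm. 2A.1). [cite: HatcherAT2002, Thm. 2A.1] -/
theorem exists_addMonoidHom_singularHomology_one_of_surjective
    (lam : Additive (FundamentalGroup Y y) →+ L) (hlam : Surjective lam) :
    ∃ μ : singularHomology ℤ ℤ Y 1 →+ L, Surjective μ ∧
      ∃ h : FundamentalGroup Y y →* Multiplicative (singularHomology ℤ ℤ Y 1),
        ∀ x, μ ((h x).toAdd) = lam (Additive.ofMul x) := by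
  obtain ⟨e⟩ := singularHomology.nonempty_abelianization_mulEquiv
    singularHomology.hurewicz_one_holds y
  -- `lam` in multiplicative clothes, through the abelianisation and the Hurewicz isomorphism
  set lamM : FundamentalGroup Y y →* Multiplicative L := AddMonoidHom.toMultiplicativeRight lam
    with hlamM
  set μM : Multiplicative (singularHomology ℤ ℤ Y 1) →* Multiplicative L :=
    (Abelianization.lift lamM).comp e.symm.toMonoidHom with hμM
  refine ⟨AddMonoidHom.toMultiplicative.symm μM, ?_, e.toMonoidHom.comp Abelianization.of, ?_⟩
  · intro l
    obtain ⟨x, hx⟩ := hlam l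
    refine ⟨((e (Abelianization.of (Additive.toMul x))) : Multiplicative _).toAdd, ?_⟩
    change (μM (Multiplicative.ofAdd ((e (Abelianization.of (Additive.toMul x))).toAdd))).toAdd = l
    rw [ofAdd_toAdd, hμM, MonoidHom.comp_apply, MulEquiv.coe_toMonoidHom, MulEquiv.symm_apply_apply,
      Abelianization.lift_apply_of, hlamM, AddMonoidHom.coe_toMultiplicativeRight]
    simp [hx]
  · intro x
    change (μM (Multiplicative.ofAdd ((e (Abelianization.of x))).toAdd)).toAdd = lam (Additive.ofMul x)
    rw [ofAdd_toAdd, hμM, MonoidHom.comp_apply, MulEquiv.coe_toMonoidHom, MulEquiv.symm_apply_apply,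
      Abelianization.lift_apply_of, hlamM, AddMonoidHom.coe_toMultiplicativeRight]
    simp

variable [Module.Finite ℚ (singularCohomology ℚ ℚ Y 1)]

/-- **A free finitely generated abelian quotient of `π₁(Y, y)` has rank `≤ b₁(Y) = dim_ℚ H¹(Y; ℚ)`.**
The coordinate functionals of a `ℤ`-basis of `L` descend to `H₁(Y; ℤ) → ℤ` (Hurewicz), i.e. to classes of
`H¹(Y; ℤ) = Hom(H₁(Y; ℤ), ℤ)` (`kroneckerPairing_one_bijective`), whose images in `H¹(Y; ℚ)`
(`ringChange_one_injective`) are `ℤ`-, hence `ℚ`-linearly independent.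
[cite: HatcherAT2002, Thm. 2A.1] [cite: HatcherAT2002, §3.1 Thm. 3.2 and p. 198]
[cite: GriffithsHarris1978, Ch. 2 §6] -/
theorem finrank_le_finrank_singularCohomology_one_of_surjective [Module.Finite ℤ L] [Module.Free ℤ L]
    (lam : Additive (FundamentalGroup Y y) →+ L) (hlam : Surjective lam) :
    Module.finrank ℤ L ≤ Module.finrank ℚ (singularCohomology ℚ ℚ Y 1) := by
  classical
  obtain ⟨μ, hμ, -⟩ := exists_addMonoidHom_singularHomology_one_of_surjective y lam hlam
  -- the `ℤ`-linear transport `Dual ℤ L → H¹(Y; ℚ)`: precompose with `μ`, invert Kronecker, change ring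
  set κ : singularCohomology ℤ ℤ Y 1 ≃ₗ[ℤ] Module.Dual ℤ (singularHomology ℤ ℤ Y 1) :=
    LinearEquiv.ofBijective (kroneckerPairing ℤ ℤ Y 1) (kroneckerPairing_one_bijective ℤ) with hκ
  -- additive maps between `ℤ`-modules are `ℤ`-linear, whatever the `ℤ`-module instances
  set μₗ : singularHomology ℤ ℤ Y 1 →ₗ[ℤ] L :=
    { toFun := μ, map_add' := map_add μ
      map_smul' := fun c x ↦ by simpa using map_intCast_smul μ ℤ ℤ c x } with hμₗ
  set ρ : singularCohomology ℤ ℤ Y 1 →ₗ[ℤ] singularCohomology ℚ ℚ Y 1 :=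
    { toFun := singularCohomology.ringChange (algebraMap ℤ ℚ) Y 1
      map_add' := map_add _
      map_smul' := fun c x ↦ by
        simpa using map_intCast_smul (singularCohomology.ringChange (algebraMap ℤ ℚ) Y 1) ℤ ℤ c x }
    with hρ
  set T : Module.Dual ℤ L →ₗ[ℤ] singularCohomology ℚ ℚ Y 1 :=
    ρ ∘ₗ κ.symm.toLinearMap ∘ₗ μₗ.dualMap with hT
  have hTinj : Injective T := by
    have h1 : Injective μₗ.dualMap := by
      intro φ₁ φ₂ h
      refine LinearMap.ext fun l ↦ ?_
      obtain ⟨m, rfl⟩ := hμ l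
      exact LinearMap.congr_fun h m
    have h2 : Injective ρ := singularCohomology.ringChange_one_injective
    rw [hT]
    exact h2.comp (κ.symm.injective.comp h1)
  -- a `ℤ`-basis of `L` and its dual basis, transported
  set b := Module.Free.chooseBasis ℤ L with hb
  have hind : LinearIndependent ℤ (T ∘ b.coord) := by
    have h0 : LinearIndependent ℤ (b.coord : Module.Free.ChooseBasisIndex ℤ L → Module.Dual ℤ L) := by
      rw [← Basis.coe_dualBasis]
      exact b.dualBasis.linearIndependent
    exact h0.map' T (LinearMap.ker_eq_bot_of_injective hTinj)
  have hindQ : LinearIndependent ℚ (T ∘ b.coord) :=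
    (LinearIndependent.iff_fractionRing ℤ ℚ).1 hind
  rw [Module.finrank_eq_card_chooseBasisIndex]
  exact hindQ.fintype_card_le_finrank

end Rank

end Literature.AlgebraicTopology.SingularHomology

end
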